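import Summits.ValiantsHypothesis.ValiantsHypothesis.Theorems.DivisionGapPerDivisionHardStubSparseRigid

/-!
# Crux `DivisionGap.PerDivisionHard` (stmt-ValiantsHypothesis-5065), line `pair-descent-jss-endpoint` —
stub `stub_sparseGraphRigid`: K2 for cofactors on a SPARSE VARIABLE GRAPH (wave 4)

`stub_sparseGraphRigid`: let `h ∈ ℝ≥0[x_ij]` (`n × n` matrix variables) be nonzero and
torus-homogeneous, and let its VARIABLE GRAPH `S = cells(h)` (the cells `(r, s)` such that `x_rs`
occurs in some monomial of `h`, `h.support.biUnion (·.support)`) have all column degrees `≤ Δ`,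
where `b (Δ + 2) ≤ n`.  Then the block arsenal with `k = 0` — the complete bipartite graph
`K_{b,b}` padded by a perfect matching `M₀` on the other `m = n - b` rows and columns — admits a
placement `eR eC : BlockV b 0 m ≃ Fin n`, a weight `w` cutting out the placed face of the
Birkhoff polytope, and a single `G`-part `u` of the top-`w` fibre of `h` (which is in fact a
single monomial).  No girth, no counting: this is the regime where K2 is easy (criterion (S) of
the refuters: `G ∩ D_h` acyclic ⇒ rigid).

Proof.
1. GREEDY EMBEDDING (`exists_core_off`): pick any `b` columns `C`; a row is bad if it meets `S`
   in a column of `C` — at most `Σ_{c ∈ C} coldeg_S(c) ≤ b Δ` bad rows, so `≥ n - b Δ ≥ 2b` good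
   rows remain; take `b` of them as `R`.  Then `R × C` is disjoint from `S`.  Label rows and
   columns so that the core labels land on `R` resp. `C` (`exists_blockEquiv`), padding
   arbitrary: the placed graph is `G = R × C ∪ {m padding cells, one per remaining row}`.
2. WEIGHT: the generic weight `genericWeight G B`, `B = deg h + 1` (`W` on `G`, `W - B^{rank e}`
   off `G`) cuts out `G` (`cutsOut_genericWeight`), because the identity matching of the labels
   lies in `K_{b,b} ⊕ M₀` (`blockAdj_zero_self`).
3. FIBRE: two monomials `m₁, m₂` of the top fibre agree off `G`
   (`eq_offG_of_mem_support_topComponent`), so `D = m₁ - m₂` is an integer matrix supported on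
   `G` with vanishing row and column sums (equal margins, `sum_diff_eq_zero`); such a matrix
   vanishes on padding rows (`placedFlow_row_notPadding`), so a nonzero entry of `D` sits at a
   core cell `(r, c) ∈ R × C` (`placedBlock_zero_core`) — but core cells are not cells of `h`,
   both `m₁` and `m₂` vanish there.  Hence the top fibre is a single monomial `m₀`, `u = m₀|_G`.

It feeds `perDivisionHard_sparseGraph` (`Theorems/DivisionGapPerDivisionHardSparseGraph.lean`):
`PerDivisionHard` for every cofactor whose variable graph has all row and column degrees
`≤ n / (log₂ n + e)^e` — polynomials of any degree and any number of monomials in the variables of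
a band, of a bounded-degree bipartite graph, of a sparse face of the Birkhoff polytope.
-/

noncomputable section

-- `Summit.ValiantsHypothesis.ValiantsHypothesis.…` is the tree's mandated single-conjunct layout
-- (Sub = Summit), so the duplicated namespace component is intended.
set_option linter.dupNamespace false

namespace Summit.ValiantsHypothesis.ValiantsHypothesis.Theorems.DivisionGapPerDivisionHard

open MvPolynomial Literature.Computability.AlgebraicComplexity
open Summit.ValiantsHypothesis.ValiantsHypothesis.Theorems.ZeroOneTransfer.Negative
open scoped NNReal

variable {n b m : ℕ}

/-! ### Greedy embedding of `K_{b,b}` off a column-sparse cell set -/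

/-- **Greedy embedding.**  If every column of the cell set `S ⊆ [n] × [n]` has at most `Δ` cells
and `b (Δ + 2) ≤ n`, there are `b` rows `R` and `b` columns `C` with `R × C` disjoint from `S`:
choose `C` arbitrarily; the rows meeting `S` inside the columns of `C` are at most `b Δ`, and
`b` of the remaining `≥ n - b Δ ≥ 2 b` rows form `R`. [folklore] -/
theorem exists_core_off (S : Finset (Fin n × Fin n)) (b Δ : ℕ) (hbn : b * (Δ + 2) ≤ n)
    (hcol : ∀ s : Fin n, (S.filter fun x => x.2 = s).card ≤ Δ) :
    ∃ R C : Finset (Fin n), R.card = b ∧ C.card = b ∧ ∀ r ∈ R, ∀ c ∈ C, (r, c) ∉ S := by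
  have hbn' : b * Δ + b * 2 ≤ n := by rwa [Nat.mul_add] at hbn
  have hb : b ≤ (Finset.univ : Finset (Fin n)).card := by
    rw [Finset.card_univ, Fintype.card_fin]
    omega
  obtain ⟨C, -, hC⟩ := Finset.exists_subset_card_eq hb
  -- the bad rows: those meeting `S` in a column of `C`
  set Bad := (S.filter fun x => x.2 ∈ C).image Prod.fst with hBad
  have hBadcard : Bad.card ≤ b * Δ :=
    calc Bad.card ≤ (S.filter fun x => x.2 ∈ C).card := Finset.card_image_le
      _ ≤ (C.biUnion fun c => S.filter fun x => x.2 = c).card := by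
          refine Finset.card_le_card fun x hx => ?_
          rw [Finset.mem_filter] at hx
          exact Finset.mem_biUnion.mpr ⟨x.2, hx.2, Finset.mem_filter.mpr ⟨hx.1, rfl⟩⟩
      _ ≤ ∑ c ∈ C, (S.filter fun x => x.2 = c).card := Finset.card_biUnion_le
      _ ≤ ∑ _c ∈ C, Δ := Finset.sum_le_sum fun c _ => hcol c
      _ = b * Δ := by rw [Finset.sum_const, smul_eq_mul, hC]
  have hgood : b ≤ (Finset.univ \ Bad).card := by
    rw [Finset.card_univ_sdiff, Fintype.card_fin]
    omega
  obtain ⟨R, hRsub, hR⟩ := Finset.exists_subset_card_eq hgood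
  refine ⟨R, C, hR, hC, fun r hr c hc hrc => ?_⟩
  have hrBad : r ∈ Bad := Finset.mem_image.mpr ⟨(r, c), Finset.mem_filter.mpr ⟨hrc, hc⟩, rfl⟩
  exact (Finset.mem_sdiff.mp (hRsub hr)).2 hrBad

/-! ### The block arsenal with `k = 0`: `K_{b,b} ⊕ M₀` -/

/-- The identity matching of the labels lies in `G(b,0) ⊕ M₀ = K_{b,b} ⊕ M₀`: core `i` — core
`i`, padding `t` — padding `t` (there are no internal labels). [folklore] -/
theorem blockAdj_zero_self (r : BlockV b 0 m) : blockAdj b 0 m r r = true := by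
  rcases r with i | ⟨_, _, t⟩ | u
  · simp [blockAdj]
  · exact t.elim0
  · simp [blockAdj]

/-- In the placed `K_{b,b} ⊕ M₀`, a cell outside the padding rows is a core cell
`(eR (inl i), eC (inl j))`. [folklore] -/
theorem placedBlock_zero_core (eR eC : BlockV b 0 m ≃ Fin n) {r c : Fin n}
    (h : (r, c) ∈ placedBlock eR eC) (hr : ∀ u, eR.symm r ≠ Sum.inr (Sum.inr u)) :
    ∃ i j, r = eR (Sum.inl i) ∧ c = eC (Sum.inl j) := by
  simp only [placedBlock, Finset.mem_filter, Finset.mem_univ, true_and] at h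
  obtain ⟨x, rfl⟩ := eR.surjective r
  obtain ⟨y, rfl⟩ := eC.surjective c
  rw [Equiv.symm_apply_apply, Equiv.symm_apply_apply] at h
  simp only [Equiv.symm_apply_apply] at hr
  rcases x with i | ⟨_, _, t⟩ | u
  · rcases y with j | ⟨_, _, t⟩ | u'
    · exact ⟨i, j, rfl, rfl⟩
    · exact t.elim0
    · simp [blockAdj] at h
  · exact t.elim0
  · exact absurd rfl (hr u)

/-! ### The stub -/

/-- **`stub_sparseGraphRigid` (K2 of line `pair-descent-jss-endpoint` for cofactors on a SPARSE
VARIABLE GRAPH, wave 4).**  A nonzero torus-homogeneous `h ∈ ℝ≥0[x_ij]` whose variable graph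
`cells(h) = h.support.biUnion (·.support)` has all row and column degrees `≤ Δ`, with
`b (Δ + 2) ≤ n`, admits a placement `eR eC` of `K_{b,b} ⊕ M₀` (the block arsenal with `k = 0`,
`m = n - b`), a weight `w` cutting out the placed face of the Birkhoff polytope, and a single
`G`-part `u` of its top-`w` fibre.  Greedy embedding of `K_{b,b}` off the cells of `h` (only the
column degrees are used), generic weight, and the fibre argument "agree off `G` + equal margins ⇒
the difference is a circulation on `G`, which vanishes on padding rows and on the core (no cell of
`h` there)".  It gives the sparse-variable-graph rung `perDivisionHard_sparseGraph` of the crux.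
[folklore] -/
theorem stub_sparseGraphRigid :
    ∀ (n b Δ : ℕ) (h : MvPolynomial (Fin n × Fin n) ℝ≥0), h ≠ 0 → IsTorusHomogeneous h → 1 ≤ b →
      b * (Δ + 2) ≤ n →
      (∀ r : Fin n, ((h.support.biUnion fun m => m.support).filter (fun x => x.1 = r)).card ≤ Δ) →
      (∀ s : Fin n, ((h.support.biUnion fun m => m.support).filter (fun x => x.2 = s)).card ≤ Δ) →
      ∃ (m : ℕ) (eR eC : BlockV b 0 m ≃ Fin n) (w : Fin n × Fin n → ℕ) (u : (Fin n × Fin n) →₀ ℕ),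
        CutsOut w (placedBlock eR eC) ∧ HasSingleGPart (placedBlock eR eC) w h u := by
  intro n b Δ h hh htor _ hbn _ hcol
  -- (1) greedy embedding of `K_{b,b}` off the cells of `h`, and the labels
  obtain ⟨R, C, hR, hC, hRC⟩ := exists_core_off (h.support.biUnion fun m => m.support) b Δ hbn hcol
  obtain ⟨eR, heR, -⟩ := exists_blockEquiv R b 0 (n - b) (by rw [hR]; ring) (by rw [hR])
  obtain ⟨eC, heC, -⟩ := exists_blockEquiv C b 0 (n - b) (by rw [hC]; ring) (by rw [hC])
  set G := placedBlock eR eC with hG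
  set B := h.totalDegree + 1 with hB
  -- (2) the generic weight cuts out `G`: the identity matching of the labels lies in the block
  obtain ⟨σ₀, hσ₀⟩ :=
    exists_perm_mem_placedBlock eR eC (Equiv.refl _) fun r => blockAdj_zero_self r
  have hcut : CutsOut (genericWeight G B) G := cutsOut_genericWeight G (Nat.succ_pos _) σ₀ hσ₀
  -- (3) the top fibre is a single monomial
  have hfib : ∀ m₁ ∈ (topComponent (genericWeight G B) h).support,
      ∀ m₂ ∈ (topComponent (genericWeight G B) h).support, m₁ = m₂ := by
    intro m₁ hm₁ m₂ hm₂
    have hs₁ := support_topComponent_subset _ h hm₁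
    have hs₂ := support_topComponent_subset _ h hm₂
    obtain ⟨r₀, c₀, hrc⟩ := htor
    have hoff := eq_offG_of_mem_support_topComponent G hm₁ hm₂
      (degree_eq_of_rowDegrees_eq ((hrc m₁ hs₁).1.trans (hrc m₂ hs₂).1.symm))
    by_contra hne
    -- the difference `D = m₁ - m₂`: supported on `G`, vanishing margins, nonzero somewhere
    obtain ⟨hrow, hcol'⟩ := sum_diff_eq_zero ((hrc m₁ hs₁).1.trans (hrc m₂ hs₂).1.symm)
      ((hrc m₁ hs₁).2.trans (hrc m₂ hs₂).2.symm)
    have hDG : ∀ e, (fun e => (m₁ e : ℤ) - m₂ e) e ≠ 0 → e ∈ G := fun e he => by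
      by_contra heG
      exact he (by simp only [hoff e heG, sub_self])
    have hDne : ∃ e, (fun e => (m₁ e : ℤ) - m₂ e) e ≠ 0 := by
      by_contra hall
      push Not at hall
      exact hne (Finsupp.ext fun e => by exact_mod_cast sub_eq_zero.mp (hall e))
    obtain ⟨⟨r, c⟩, hrc'⟩ := hDne
    -- a nonzero entry of `D` is not in a padding row, hence at a core cell ...
    have hpad := placedFlow_row_notPadding eR eC hDG hrow hcol' hrc'
    obtain ⟨i, j, rfl, rfl⟩ := placedBlock_zero_core eR eC (hDG _ hrc') hpad
    -- ... which is not a cell of `h`: both monomials vanish there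
    have hnot : (eR (Sum.inl i), eC (Sum.inl j)) ∉ h.support.biUnion (fun m => m.support) :=
      hRC _ (heR i) _ (heC j)
    have h0 : ∀ m' ∈ h.support, m' (eR (Sum.inl i), eC (Sum.inl j)) = 0 := fun m' hm' => by
      by_contra hne'
      exact hnot (Finset.mem_biUnion.mpr ⟨m', hm', Finsupp.mem_support_iff.mpr hne'⟩)
    exact hrc' (by simp only [h0 m₁ hs₁, h0 m₂ hs₂, Nat.cast_zero, sub_self])
  -- conclusion: `u` is the `G`-part of the unique monomial of the top fibre
  obtain ⟨m₀, hm₀⟩ := support_nonempty.mpr (topComponent_ne_zero (genericWeight G B) hh)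
  refine ⟨n - b, eR, eC, genericWeight G B, m₀.filter (· ∈ G), hcut, fun e he => ?_,
    fun m' hm' e he => ?_⟩
  · rw [Finsupp.support_filter] at he
    exact (Finset.mem_filter.mp he).2
  · rw [hfib m' hm' m₀ hm₀, Finsupp.filter_apply_pos _ _ he]

end Summit.ValiantsHypothesis.ValiantsHypothesis.Theorems.DivisionGapPerDivisionHard

end
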